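import Summits.Ventures.Crystal3D.Theorems.StickyWulffConstantCoaxialWallLawWordRootSeparation
import HarnessLib

/-!
# ROOT SEPARATION, same root: distinct well-formed chains of one root never share a direction (v2 end uniqueness)

HONEST FRAMING. Venture `Summits/Ventures/Crystal3D` (cell `crystal3d-full`), helper `--supports` the crux
`CoaxialWallLaw` of `route-Ventures-StickyWulffConstant` (REGISTERED line `WallLedgerF`).  Rung credit; F-C1 not
moved; no census, no kissing facts; pure word algebra.  cf-p1 g28 (xxxviii″): in the `v2` automaton a ball may carry
TWO moving (NARROW) states, so the v1 argument «a moving ball carries one certified state» (`word_state_eq_of_moving`)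
no longer makes the end export `(b, κ) ↦ (b, b − d κ)` injective; what replaces it is injectivity of the DIRECTION
on the classes of one family — the same-root companion of `word_dir_ne_of_roots_ne` (`…WordRootSeparation`):

* **`word_dir_injective`** — for a word system (`F (μ :: κ) = M_μ ≫ F κ`, `u (μ :: κ) = −u κ`, `u [] ∈ fccSlots`,
  well-formedness `WF` as in `word_endPairs_multiExcl`): `WF κ → WF κ′ → F κ (u κ) = F κ′ (u κ′) → κ = κ′`.
  Proof: peel the common deepest suffix `τ` (`exists_common_suffix`); the glued mirror chain `α ++ α′.reverse` is a
  `±1/3`-chain of unit model menu normals all oblique to the root (`word_letters_oblique_of_wf`; at the junction the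
  two deepest letters are distinct and, by `word_inner_u_getLast`, not antipodal) taking the slot `u κ` to the
  lattice vector `u κ′` — impossible for a nonempty chain by the 3-adic non-return `foldl_reflect_not_mem_fcc`.
WHAT THIS IS NOT: the v2 export itself (next files); F-C1 not moved.
-/

noncomputable section

namespace Summit.Ventures.Crystal3D.Theorems

open Summit.Ventures.Crystal3D Finset
open Literature.MathematicalPhysics.StatisticalMechanics (fccStacking)
open scoped InnerProductSpace

variable {F : List (EuclideanSpace ℝ (Fin 3)) → (EuclideanSpace ℝ (Fin 3) ≃ₗᵢ[ℝ] EuclideanSpace ℝ (Fin 3))}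
  {u : List (EuclideanSpace ℝ (Fin 3)) → EuclideanSpace ℝ (Fin 3)}
  {WF : List (EuclideanSpace ℝ (Fin 3)) → Prop}

/-- **Same-root separation: the direction determines the chain.**  See the module docstring. -/
theorem word_dir_injective (hFc : ∀ μ κ, F (μ :: κ) = ((ℝ ∙ μ)ᗮ.reflection).trans (F κ))
    (huc : ∀ μ κ, u (μ :: κ) = -u κ)
    (hWFc : ∀ μ κ, WF (μ :: κ) ↔ (WF κ ∧ ‖μ‖ = 1 ∧
      (∀ w ∈ fccSlots, ⟪w, μ⟫_ℝ = 0 ∨ ⟪w, μ⟫_ℝ = Real.sqrt (2 / 3) ∨ ⟪w, μ⟫_ℝ = -Real.sqrt (2 / 3)) ∧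
      ⟪u κ, μ⟫_ℝ = Real.sqrt (2 / 3) ∧ ∀ μ' κ', κ = μ' :: κ' → μ' ≠ -μ))
    (hu0 : u [] ∈ fccSlots) {κ κ' : List (EuclideanSpace ℝ (Fin 3))} (hκ : WF κ) (hκ' : WF κ')
    (heq : F κ (u κ) = F κ' (u κ')) : κ = κ' := by
  have hr : 0 < Real.sqrt (2 / 3) := Real.sqrt_pos.2 (by norm_num)
  obtain ⟨α, α', τ, rfl, rfl, hne⟩ := exists_common_suffix κ κ'
  -- letters and chains of the two words
  obtain ⟨hlet, hchain⟩ := word_letters_of_wf huc hWFc _ hκ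
  obtain ⟨hlet', hchain'⟩ := word_letters_of_wf huc hWFc _ hκ'
  have hob := word_letters_oblique_of_wf huc hWFc _ hκ
  have hob' := word_letters_oblique_of_wf huc hWFc _ hκ'
  have hαu : ∀ μ ∈ α, ‖μ‖ = 1 := fun μ hμ => (hlet μ (List.mem_append_left τ hμ)).1
  have hα'u : ∀ μ ∈ α', ‖μ‖ = 1 := fun μ hμ => (hlet' μ (List.mem_append_left τ hμ)).1
  -- it suffices that the glued list `α ++ α'.reverse` is empty
  suffices h : α ++ α'.reverse = [] by
    obtain ⟨h1, h2⟩ := List.append_eq_nil_iff.1 h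
    rw [h1, List.reverse_eq_nil_iff.1 h2]
  by_contra hL
  obtain ⟨μ₁, g, hg⟩ := List.exists_cons_of_ne_nil hL
  -- the glued mirror chain takes the slot `u (α ++ τ)` to the lattice vector `u (α' ++ τ)`
  have hglue : (α ++ α'.reverse).foldl (fun (y : EuclideanSpace ℝ (Fin 3)) μ => y - (2 * ⟪y, μ⟫_ℝ) • μ)
      (u (α ++ τ)) = u (α' ++ τ) := by
    rw [List.foldl_append]
    have e : α.foldl (fun (y : EuclideanSpace ℝ (Fin 3)) μ => y - (2 * ⟪y, μ⟫_ℝ) • μ) (u (α ++ τ)) =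
        α'.foldl (fun (y : EuclideanSpace ℝ (Fin 3)) μ => y - (2 * ⟪y, μ⟫_ℝ) • μ) (u (α' ++ τ)) := by
      apply (F τ).injective
      rw [← word_F_append_apply hFc α hαu τ, ← word_F_append_apply hFc α' hα'u τ]; exact heq
    rw [e]; exact foldl_reflect_reverse_foldl α' hα'u _
  -- letters of the glued list: unit model menu normals, oblique to the root
  have hletg : ∀ μ ∈ μ₁ :: g, ‖μ‖ = 1 ∧
      ∀ w ∈ fccSlots, ⟪w, μ⟫_ℝ = 0 ∨ ⟪w, μ⟫_ℝ = Real.sqrt (2 / 3) ∨ ⟪w, μ⟫_ℝ = -Real.sqrt (2 / 3) := by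
    intro μ hμ
    rw [← hg] at hμ
    rcases List.mem_append.1 hμ with h | h
    · exact hlet μ (List.mem_append_left τ h)
    · exact hlet' μ (List.mem_append_left τ (List.mem_reverse.1 h))
  have hobg : ∀ μ ∈ μ₁ :: g, ⟪u [], μ⟫_ℝ = Real.sqrt (2 / 3) ∨ ⟪u [], μ⟫_ℝ = -Real.sqrt (2 / 3) := by
    intro μ hμ
    rw [← hg] at hμ
    rcases List.mem_append.1 hμ with h | h
    · exact hob μ (List.mem_append_left τ h)
    · exact hob' μ (List.mem_append_left τ (List.mem_reverse.1 h))
  -- the chain condition, with the junction of the two deepest letters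
  have hchg : List.IsChain (fun μ μ' => ⟪μ, μ'⟫_ℝ = 1 / 3 ∨ ⟪μ, μ'⟫_ℝ = -1 / 3) (μ₁ :: g) := by
    rw [← hg, List.isChain_append]
    refine ⟨hchain.left_of_append, ?_, ?_⟩
    · rw [List.isChain_reverse]
      exact hchain'.left_of_append.imp fun a b h => by rw [real_inner_comm]; exact h
    · intro x hx y hy
      rw [List.head?_reverse] at hy
      have hxy : x ≠ y := hne x hx y hy
      obtain ⟨hx1, hxm⟩ := hlet x (List.mem_append_left τ (List.mem_of_getLast? hx))
      obtain ⟨hy1, hym⟩ := hlet' y (List.mem_append_left τ (List.mem_of_getLast? hy))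
      have hux : ⟪u τ, x⟫_ℝ = Real.sqrt (2 / 3) := word_inner_u_getLast hWFc α τ hκ x hx
      have huy : ⟪u τ, y⟫_ℝ = Real.sqrt (2 / 3) := word_inner_u_getLast hWFc α' τ hκ' y hy
      refine menuNormals_chain_of_ne_of_ne_neg hx1 hy1 hxm hym hxy fun hyx => ?_
      rw [hyx, inner_neg_right, hux] at huy
      linarith
  -- the starting slot and the obliqueness of the first letter
  have hus : u (α ++ τ) ∈ fccSlots := word_u_mem hu0 rfl huc _
  have hobl : ⟪u (α ++ τ), μ₁⟫_ℝ = Real.sqrt (2 / 3) ∨ ⟪u (α ++ τ), μ₁⟫_ℝ = -Real.sqrt (2 / 3) := by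
    rw [word_u_eq_pow_smul huc (α ++ τ), real_inner_smul_left]
    rcases neg_one_pow_eq_or ℝ (α ++ τ).length with h | h <;>
      rcases hobg μ₁ List.mem_cons_self with h' | h' <;> rw [h, h']
    · left; ring
    · right; ring
    · right; ring
    · left; ring
  have key := foldl_reflect_not_mem_fcc μ₁ g hletg hchg hus hobl
  rw [← hg, hglue] at key
  exact key (mem_fcc_of_mem_fccSlots (word_u_mem hu0 rfl huc _))

end Summit.Ventures.Crystal3D.Theorems

end
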